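import Mathlib
import HarnessLib
import Summits.Ventures.LatticeQCDFlow.Exactness.FlowSamplerFluxSymmetricAcceptance
import Summits.Ventures.LatticeQCDFlow.Exactness.OffDiagonalDominationLagOne

/-!
# Among ALL exact accept/reject rules for flow proposals, Metropolis accepts most and decorrelates most at lag one: every flux-symmetric rule is
# pointwise below `min(1, w(y)/w(x))`, hence has the larger stationary lag-one autocorrelation of every bounded observable (general state space)

HONEST FRAMING: exact (Metropolis-corrected) sampling algorithms for lattice gauge theory;
figures of merit are autocorrelation/cost numbers at stated couplings and volumes; no
continuum-physics claim.

Venture `LatticeQCDFlow` (cell pub-lqcd), topic `Exactness`; FANOUT row 30 (lean-1, GEN-42).  NEW WORK of the cell, the junction of this generation's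
`FlowSamplerFluxSymmetricAcceptance` (every rule `a ≤ 1` with `w(x)a(x, y) = w(y)a(y, x)` is exact: Barker, delayed acceptance, Kennedy–Kuti, …)
and `OffDiagonalDominationLagOne` (off-diagonal domination orders the stationary lag-one product moment).  Peskun's 1973 optimality of the
Metropolis rule, in its one-step form, on a general state space, for the flow sampler.  Nothing is cited as a fact.

## Results (no `sorry`, no new definitions)
* **`fluxSymmetric_le_imhAccept`** — ANY acceptance `a ≤ 1` with the flux symmetry satisfies `a(x, y) ≤ min(1, w(y)/w(x))` pointwise: METROPOLIS
  ACCEPTS MOST among exact rules (`w(x)a(x, y) = w(y)a(y, x) ≤ w(y)`).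
* `fluxSymmetric_apply_le_imh` — hence its kernel is dominated by `indepMH q w` on every set off the current state.
* **`imh_lagOne_le_fluxSymmetric`** — and for every measurable `0 ≤ f ≤ c`, at stationarity (`π = w·q` a probability law):
  `∫∫ f(x)f(y) K_MH(x, dy)π(dx) ≤ ∫∫ f(x)f(y) K_a(x, dy)π(dx)` — METROPOLIS HAS THE SMALLEST LAG-ONE AUTOCORRELATION OF EVERY SUCH OBSERVABLE
  among all flux-symmetric rules on the same flow proposals (Barker, delayed acceptance with any surrogate, the linear rule, …).
Reading (gauge files): whatever cheaper or noise-tolerant accept rule an exact flow sampler adopts (screening with the gauge action, Barker for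
coin-flip implementations, the linear rule for unbiased ratio estimates), it pays in acceptance and in lag-one autocorrelation relative to the
plain Metropolis test on the same proposals; the gain must come from cost per step.  NOT CLAIMED: the all-lag (asymptotic variance) optimality.
-/

noncomputable section

namespace Summit.Ventures.LatticeQCDFlow.Exactness

open MeasureTheory ProbabilityTheory
open scoped ENNReal

variable {Ω : Type*} [MeasurableSpace Ω] {q : Measure Ω} [IsProbabilityMeasure q] {w : Ω → ℝ}

omit [MeasurableSpace Ω] in
/-- **METROPOLIS ACCEPTS MOST**: a flux-symmetric acceptance `a ≤ 1` is pointwise below the Metropolis acceptance `min(1, w(y)/w(x))`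
(in `ℝ≥0∞`: `a(x, y) ≤ imhAcceptE w x y`). [ours] -/
theorem fluxSymmetric_le_imhAccept (hw0 : ∀ x, 0 < w x) {a : Ω → Ω → ℝ≥0∞} (ha1 : ∀ x y, a x y ≤ 1)
    (hsym : ∀ x y, ENNReal.ofReal (w x) * a x y = ENNReal.ofReal (w y) * a y x) (x y : Ω) :
    a x y ≤ imhAcceptE w x y := by
  unfold imhAcceptE imhAccept
  rw [ENNReal.ofReal_min, ENNReal.ofReal_one]
  refine le_min (ha1 x y) ?_
  -- `w(x) a(x,y) = w(y) a(y,x) ≤ w(y)`, divide by `w(x) > 0`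
  have hflux : ENNReal.ofReal (w x) * a x y ≤ ENNReal.ofReal (w y) := by
    rw [hsym x y]
    calc ENNReal.ofReal (w y) * a y x ≤ ENNReal.ofReal (w y) * 1 := mul_le_mul' le_rfl (ha1 y x)
      _ = ENNReal.ofReal (w y) := mul_one _
  have hx0 : ENNReal.ofReal (w x) ≠ 0 := ne_of_gt (ENNReal.ofReal_pos.2 (hw0 x))
  rw [ENNReal.ofReal_div_of_pos (hw0 x)]
  rw [ENNReal.le_div_iff_mul_le (Or.inl hx0) (Or.inl ENNReal.ofReal_ne_top), mul_comm]
  exact hflux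

/-- **… HENCE ITS KERNEL IS DOMINATED BY THE METROPOLIS KERNEL OFF THE CURRENT STATE**: `K_a(x, B) ≤ indepMH q w (x, B)` for every measurable
`B ∌ x`. [ours] -/
theorem fluxSymmetric_apply_le_imh (hw : Measurable w) (hw0 : ∀ x, 0 < w x) {a : Ω → Ω → ℝ≥0∞} (ha1 : ∀ x y, a x y ≤ 1)
    (hsym : ∀ x y, ENNReal.ofReal (w x) * a x y = ENNReal.ofReal (w y) * a y x)
    (K : Kernel Ω Ω) (hK : ∀ (x : Ω) {B : Set Ω}, MeasurableSet B → K x B = ∫⁻ y in B, a x y ∂q + (1 - ∫⁻ y, a x y ∂q) * B.indicator 1 x)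
    {x : Ω} {B : Set Ω} (hB : MeasurableSet B) (hx : x ∉ B) : K x B ≤ indepMH q w x B := by
  rw [hK x hB, indepMH_apply hw x hB, Set.indicator_of_notMem hx, mul_zero, add_zero, mul_zero, add_zero]
  exact lintegral_mono fun y => fluxSymmetric_le_imhAccept hw0 ha1 hsym x y

/-- **METROPOLIS HAS THE SMALLEST LAG-ONE AUTOCORRELATION AMONG ALL EXACT ACCEPT/REJECT RULES ON THE SAME FLOW PROPOSALS**: for a normalised
positive weight, any flux-symmetric rule `a ≤ 1` with kernel `K_a`, and every measurable `0 ≤ f ≤ c`,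
`∫∫ f(x)f(y) indepMH(x, dy)π(dx) ≤ ∫∫ f(x)f(y) K_a(x, dy)π(dx)` at stationarity. [ours] -/
theorem imh_lagOne_le_fluxSymmetric [MeasurableSingletonClass Ω] (hw : Measurable w) (hw0 : ∀ x, 0 < w x)
    [IsProbabilityMeasure (q.withDensity fun x => ENNReal.ofReal (w x))] {a : Ω → Ω → ℝ≥0∞} (ha : Measurable (Function.uncurry a))
    (ha1 : ∀ x y, a x y ≤ 1) (hsym : ∀ x y, ENNReal.ofReal (w x) * a x y = ENNReal.ofReal (w y) * a y x)
    (K : Kernel Ω Ω) [IsMarkovKernel K]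
    (hK : ∀ (x : Ω) {B : Set Ω}, MeasurableSet B → K x B = ∫⁻ y in B, a x y ∂q + (1 - ∫⁻ y, a x y ∂q) * B.indicator 1 x)
    {f : Ω → ℝ} (hf : Measurable f) (hf0 : ∀ x, 0 ≤ f x) {c : ℝ} (hfc : ∀ x, f x ≤ c) :
    haveI : Fact (Measurable w) := ⟨hw⟩
    ∫⁻ x, ∫⁻ y, ENNReal.ofReal (f x * f y) ∂(indepMH q w x) ∂(q.withDensity fun x => ENNReal.ofReal (w x)) ≤
      ∫⁻ x, ∫⁻ y, ENNReal.ofReal (f x * f y) ∂(K x) ∂(q.withDensity fun x => ENNReal.ofReal (w x)) := by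
  haveI : Fact (Measurable w) := ⟨hw⟩
  exact lagOne_cross_antitone (indepMH q w) K (fun x B hB hx => fluxSymmetric_apply_le_imh hw hw0 ha1 hsym K hK hB hx)
    (q.withDensity fun x => ENNReal.ofReal (w x)) (indepMH_invariant hw hw0) (fluxSymmetric_invariant hw ha hsym K hK) hf hf0 hfc

end Summit.Ventures.LatticeQCDFlow.Exactness
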